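import Summits.AnomalousDissipation.AnomalousDissipation.Theorems.SolenoidalFractalHomogenisationLagrangianStepCellChainGapOfClassPair
import Summits.AnomalousDissipation.AnomalousDissipation.Theorems.SolenoidalFractalHomogenisationLagrangianStepCellChainGap
import Summits.AnomalousDissipation.AnomalousDissipation.Theorems.SolenoidalFractalHomogenisationLagrangianStepCellChainClassPairFrame
import HarnessLib

/-!
# K1L_D (stmt-AnomalousDissipation-27980), (ℓ3) (D-TH)₀ — the SPECTRAL GAP off the chain for FROZEN-FRAME solutions
# (helper; `--supports stmt-AnomalousDissipation-27980 --as helper`)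

Port plan B7 (`HOME/ad-sawtooth-k1loc-p1/g16/W7thg-portplan-k1locp1g16.md`; prover ad-sawtooth-k1loc-p1 g16): the frozen-frame twins of
`CellChain.ae_gap_lower_bound` (`…CellChainGap`) and `CellChain.ae_gap_of_classPair(_half)` (`…CellChainGapOfClassPair`).  The pure pieces
`gap_lower_bound` (any symbol) and `energy_le_exp_of_gap` (pure real analysis) are reused BY NAME.  What changes: the solution is a CONSTANT-FRAME
distorted weak solution, the symbol is the conjugated one `symbT (conj G₀ 𝔹)`, and the per-mode COERCIVITY `lo″·|k|²‖û(k)‖² ≤ Re⟪û, T û⟫` is taken as an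
a.e. HYPOTHESIS — it is a conjunct of the frozen energy package `CellChain.exists_energyRep_cell_frame` with `lo″ = lo'·c₀` (frame non-degeneracy
`c₀|k|² ≤ |G₀ᵀk|²`); class-pair confinement comes from `ae_modes_vanish_off_classPair_frame` (p729001).
* `ae_gap_lower_bound_frame`, `ae_gap_of_classPair_frame`, `ae_gap_of_classPair_half_frame`.
No definitions, no sorry.  NOT a proof of `stub_W7thg`, of K1L_D or of AD; rung F-D1.A0.
[cite: Temam1984, Ch. III §1 Lemma 1.2 (energy inequality)] [cite: KhaKuchment2021, §1.1–§1.2 (G-periodic operators, γ_k-automorphic functions)] [problem: turb]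
-/

set_option linter.dupNamespace false

noncomputable section

namespace Summit.AnomalousDissipation.AnomalousDissipation.Theorems.SolenoidalFractalHomogenisation.LagrangianStep.CellChain

open Set MeasureTheory Filter Topology Function Complex UnitAddTorus
open scoped InnerProductSpace ComplexConjugate
open Literature.Analysis Literature.Analysis.FunctionSpaces Literature.Analysis.FunctionSpaces.Torus
open Literature.Analysis.FluidPDE Literature.Analysis.FluidPDE.Torus Literature.Analysis.FluidPDE.LatticeShear
open Summit.AnomalousDissipation.AnomalousDissipation.Theorems.SolenoidalFractalHomogenisation.RealisedQuasiStaticCellLaw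
open Summit.AnomalousDissipation.AnomalousDissipation.Theorems.SolenoidalFractalHomogenisation.LagrangianStep
open Summit.AnomalousDissipation.AnomalousDissipation.Theorems.SolenoidalFractalHomogenisation.LagrangianStep.W7Engine

/-- **Spectral-gap lower bound, a.e. along a FROZEN-FRAME weak solution**: with `E = ∫‖u t‖²` a.e., the finite-block bounds of `Q` for the
conjugated symbol and the per-mode coercivity `lo″·|k|²‖û‖² ≤ Re⟪û, T_{𝔹^{G₀}} û⟫` (conjuncts of `exists_energyRep_cell_frame`), if for a.e. `t` every
mode of `u t` has `|k|² ≥ ρ`, then `4π²·lo″·ρ·E t ≤ Q t` for a.e. `t ∈ (0,T)`. [cite: Temam1984, Ch. III §1 Lemma 1.2 (energy inequality)] -/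
theorem ae_gap_lower_bound_frame {T : ℝ} {𝔹 : Torus.Visc4 (Fin 3)} {b u : ℝ → UnitAddTorus (Fin 3) → EuclideanSpace ℝ (Fin 3)}
    {G₀ : Matrix (Fin 3) (Fin 3) ℝ} {F : UnitAddTorus (Fin 3) → EuclideanSpace ℝ (Fin 3)}
    (h : Torus.IsWeakTensorPassiveVectorDistortedOn 0 T 𝔹 b (fun _ _ => G₀) F u) {lo'' : ℝ} (hlo : 0 ≤ lo'') {E Q : ℝ → ℝ}
    (hE : ∀ᵐ t ∂(volume.restrict (Ioo 0 T)), E t = ∫ x, ‖u t x‖ ^ 2)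
    (hQ : ∀ᵐ t ∂(volume.restrict (Ioo 0 T)), ∀ S : Finset (Fin 3 → ℤ),
      4 * Real.pi ^ 2 * ∑ k ∈ S, (⟪mFourierCoeff (EuclideanSpace.complexify ∘ u t) k,
        Torus.symbT (Torus.Visc4.conj G₀ 𝔹) k (mFourierCoeff (EuclideanSpace.complexify ∘ u t) k)⟫_ℂ).re ≤ Q t)
    (hcoer : ∀ᵐ t ∂(volume.restrict (Ioo 0 T)), ∀ k : Fin 3 → ℤ,
      lo'' * (freqNormSq k * ‖mFourierCoeff (EuclideanSpace.complexify ∘ u t) k‖ ^ 2) ≤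
        (⟪mFourierCoeff (EuclideanSpace.complexify ∘ u t) k,
          Torus.symbT (Torus.Visc4.conj G₀ 𝔹) k (mFourierCoeff (EuclideanSpace.complexify ∘ u t) k)⟫_ℂ).re)
    {ρ : ℝ} (hρ : 0 ≤ ρ)
    (hgap : ∀ᵐ t ∂(volume.restrict (Ioo 0 T)), ∀ k, mFourierCoeff (EuclideanSpace.complexify ∘ u t) k ≠ 0 → ρ ≤ freqNormSq k) :
    ∀ᵐ t ∂(volume.restrict (Ioo 0 T)), 4 * Real.pi ^ 2 * lo'' * ρ * E t ≤ Q t := by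
  filter_upwards [hE, hQ, hgap, hcoer, h.ae_memLp_two] with t hEt hQt hgapt hcoert h2
  have hpars : HasSum (fun k => ‖mFourierCoeff (EuclideanSpace.complexify ∘ u t) k‖ ^ 2) (E t) := by
    rw [hEt]; exact hasSum_sq_norm_mFourierCoeff_complexify h2
  exact gap_lower_bound hlo hρ hpars hQt hcoert hgapt

/-- **`hgap` from class-pair confinement, frozen frame**: for a constant-frame solution from a datum on the class pair of `ℓ`, every carried mode `k`
off the ten window vectors `±(ℓ + j·Ks)`, `|j| ≤ 2`, has `dmin ≤ 8π²·lo'·|k|²` provided `dmin ≤ 8π²·lo'·(n − ‖ℓ‖)²`, `‖ℓ‖ ≤ n`.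
[cite: KhaKuchment2021, §1.1–§1.2 (G-periodic operators, γ_k-automorphic functions)] -/
theorem ae_gap_of_classPair_frame {k₀ : ℕ} (W : LatticeWord k₀) (M : ℝ) (hM : 0 < M) {lo hi lam ν : ℝ} (hlo : 0 < lo)
    (hlam : 0 < lam) (hν : 0 < ν) {n : ℕ} (hn : 0 < n) {𝔸 : Torus.Visc4 (Fin 3)}
    (hA : Torus.NearIso 𝔸 (ν * (lo / lam)) (ν * (hi * lam))) {G₀ : Matrix (Fin 3) (Fin 3) ℝ} {c₀ : ℝ} (hc₀ : 0 < c₀)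
    (hG : ∀ k' : Fin 3 → ℤ, c₀ * freqNormSq k' ≤ ∑ a, Torus.twistFreq G₀ k' a ^ 2)
    (ℓ : Fin 3 → ℤ) {F : VF} (hF : MemLp F 2 volume)
    (hsupp : ∀ k' : Fin 3 → ℤ, (¬ ∃ z : Fin 3 → ℤ, k' = ℓ + (n : ℤ) • z) → (¬ ∃ z : Fin 3 → ℤ, k' = -ℓ + (n : ℤ) • z) →
      mFourierCoeff (FunctionSpaces.EuclideanSpace.complexify ∘ F) k' = 0)
    {T : ℝ} {u : ℝ → VF}
    (hu : Torus.IsWeakTensorPassiveVectorDistortedOn 0 T ((1 / (n:ℝ) ^ 2) • 𝔸) (cellField W M hM ν hν n) (fun _ _ => G₀) F u)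
    (Ks : Fin 3 → ℤ) {lo' dmin : ℝ} (hlo' : 0 ≤ lo') (hdmin : dmin ≤ 8 * Real.pi ^ 2 * lo' * ((n : ℝ) - ‖Torus.latticeVec ℓ‖) ^ 2)
    (hℓn : ‖Torus.latticeVec ℓ‖ ≤ n) :
    ∀ᵐ t ∂(volume.restrict (Ioo 0 T)), ∀ k : Fin 3 → ℤ,
      (∀ j ∈ ({-2, -1, 0, 1, 2} : Finset ℤ), k ≠ ℓ + j • Ks ∧ k ≠ -(ℓ + j • Ks)) →
      mFourierCoeff (EuclideanSpace.complexify ∘ u t) k ≠ 0 → dmin ≤ 8 * Real.pi ^ 2 * lo' * freqNormSq k := by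
  filter_upwards [ae_modes_vanish_off_classPair_frame W M hM hlo hlam hν hn hA hc₀ hG ℓ hF hsupp hu] with t ht k hoff hk
  have hmem : (∃ z : Fin 3 → ℤ, k = ℓ + (n : ℤ) • z) ∨ (∃ z : Fin 3 → ℤ, k = -ℓ + (n : ℤ) • z) := by
    by_contra hcon
    rw [not_or] at hcon
    exact hk (ht k hcon.1 hcon.2)
  have h0 := hoff 0 (by norm_num)
  rw [zero_zsmul, add_zero] at h0
  have hge := norm_latticeVec_ge_of_classPair_ne hmem h0.1 h0.2
  have hnn : 0 ≤ (n : ℝ) - ‖Torus.latticeVec ℓ‖ := sub_nonneg.2 hℓn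
  have hsq : ((n : ℝ) - ‖Torus.latticeVec ℓ‖) ^ 2 ≤ freqNormSq k := by
    rw [← norm_latticeVec_sq']
    exact pow_le_pow_left₀ hnn hge 2
  exact hdmin.trans (mul_le_mul_of_nonneg_left hsq (by positivity))

/-- The same with the window number `dmin ≤ 2π²·lo'·n²` under `2‖ℓ‖ ≤ n`. [cite: KhaKuchment2021, §1.1–§1.2 (G-periodic operators, γ_k-automorphic functions)] -/
theorem ae_gap_of_classPair_half_frame {k₀ : ℕ} (W : LatticeWord k₀) (M : ℝ) (hM : 0 < M) {lo hi lam ν : ℝ} (hlo : 0 < lo)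
    (hlam : 0 < lam) (hν : 0 < ν) {n : ℕ} (hn : 0 < n) {𝔸 : Torus.Visc4 (Fin 3)}
    (hA : Torus.NearIso 𝔸 (ν * (lo / lam)) (ν * (hi * lam))) {G₀ : Matrix (Fin 3) (Fin 3) ℝ} {c₀ : ℝ} (hc₀ : 0 < c₀)
    (hG : ∀ k' : Fin 3 → ℤ, c₀ * freqNormSq k' ≤ ∑ a, Torus.twistFreq G₀ k' a ^ 2)
    (ℓ : Fin 3 → ℤ) {F : VF} (hF : MemLp F 2 volume)
    (hsupp : ∀ k' : Fin 3 → ℤ, (¬ ∃ z : Fin 3 → ℤ, k' = ℓ + (n : ℤ) • z) → (¬ ∃ z : Fin 3 → ℤ, k' = -ℓ + (n : ℤ) • z) →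
      mFourierCoeff (FunctionSpaces.EuclideanSpace.complexify ∘ F) k' = 0)
    {T : ℝ} {u : ℝ → VF}
    (hu : Torus.IsWeakTensorPassiveVectorDistortedOn 0 T ((1 / (n:ℝ) ^ 2) • 𝔸) (cellField W M hM ν hν n) (fun _ _ => G₀) F u)
    (Ks : Fin 3 → ℤ) {lo' dmin : ℝ} (hlo' : 0 ≤ lo') (hdmin : dmin ≤ 2 * Real.pi ^ 2 * lo' * (n : ℝ) ^ 2)
    (hℓn : 2 * ‖Torus.latticeVec ℓ‖ ≤ n) :
    ∀ᵐ t ∂(volume.restrict (Ioo 0 T)), ∀ k : Fin 3 → ℤ,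
      (∀ j ∈ ({-2, -1, 0, 1, 2} : Finset ℤ), k ≠ ℓ + j • Ks ∧ k ≠ -(ℓ + j • Ks)) →
      mFourierCoeff (EuclideanSpace.complexify ∘ u t) k ≠ 0 → dmin ≤ 8 * Real.pi ^ 2 * lo' * freqNormSq k := by
  have hℓn' : ‖Torus.latticeVec ℓ‖ ≤ n := by linarith [norm_nonneg (Torus.latticeVec ℓ)]
  have hdmin' : dmin ≤ 8 * Real.pi ^ 2 * lo' * ((n : ℝ) - ‖Torus.latticeVec ℓ‖) ^ 2 := by
    have h4 : (n : ℝ) ^ 2 ≤ 4 * ((n : ℝ) - ‖Torus.latticeVec ℓ‖) ^ 2 := by nlinarith [norm_nonneg (Torus.latticeVec ℓ)]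
    have : 2 * Real.pi ^ 2 * lo' * (n : ℝ) ^ 2 ≤ 8 * Real.pi ^ 2 * lo' * ((n : ℝ) - ‖Torus.latticeVec ℓ‖) ^ 2 := by
      have hc : 0 ≤ 2 * Real.pi ^ 2 * lo' := by positivity
      nlinarith
    exact hdmin.trans this
  exact ae_gap_of_classPair_frame W M hM hlo hlam hν hn hA hc₀ hG ℓ hF hsupp hu Ks hlo' hdmin' hℓn'

end Summit.AnomalousDissipation.AnomalousDissipation.Theorems.SolenoidalFractalHomogenisation.LagrangianStep.CellChain

end
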